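import Summits.HodgeConjecture.HodgeConjecture.Theorems.WeilTypeLadderOnPath
import Summits.HodgeConjecture.HodgeConjecture.Theses.SupersingularIsotypicLift
import Summits.HodgeConjecture.HodgeConjecture.Theses.RankFourFaces
import Literature.AlgebraicGeometry.HodgeTheory.WeilClassesMoonenZarhinCriterion
import Literature.AlgebraicGeometry.HodgeTheory.AbelianVarietyPullbackAlgebraicClasses
import Literature.AlgebraicGeometry.HodgeTheory.LefschetzOneOneHolds
import Literature.AlgebraicGeometry.HodgeTheory.HodgeConjecture
import Literature.AlgebraicGeometry.HodgeTheory.WeilClassesCMReduction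
import HarnessLib

/-!
# WeilTypeLadder · André's CM reduction typed: `[André 1992] ∧ R∞ ∧ R3 ⟹ HC for abelian varieties of CM type`

b2b cell `hweil` (packet `run/shared/lean/b2b/hodge-weil/`; LADDER.md v0 row "R5 (CM type / André)", CARVER C4:
"André's reduction itself is NOT typed", CLAIM TABLE row P2-next (i)). Prover 2, generation 2 (variational).

The top of Markman's programme for CM fields (ICM survey arXiv:2509.23403, Thm. 1.4 and §12; companion
arXiv:2509.23079 §1.1: "With André … the right-hand sides over all `(K, d)` give HC for all abelian varieties
of CM-type") is the classical reduction of Y. André, *Une remarque à propos des cycles de Hodge de type CM*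
(Sém. Théorie des Nombres Paris 1989–90, Progr. Math. 102, Birkhäuser 1992, 1–7) = Charles–Schnell, Thm. 11.5.21
= Milne's endnote M.12 to Deligne's LNM 900 article: **every Hodge class on a complex abelian variety of CM type
is a sum of pull-backs, along homomorphisms, of Weil classes `⋀^{2k}_E H¹` of abelian varieties of (split)
Weil type relative to a CM field `E`.** Here:

* the theorem itself is the NAMED FACT `Andre1992_hodgeClasses_cmAbelianVariety_mem_span_pullback_weilClasses`
  (`Literature/AlgebraicGeometry/HodgeTheory/WeilClassesCMReduction.lean`, this seat; Charles–Schnell Thm. 11.5.21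
  and Milne's endnote M.12 quoted there), stated on the tree's real carriers in the vocabulary of the conjecture
  leaf `Theorems/WeilTypeLadder.lean` (`weilClassesOf` for `[E:ℚ] = 2`, `weilClassesField` for `[E:ℚ] > 2`,
  binders copied symbol by symbol from `WeilClassesImaginaryQuadratic` / `WeilClassesCMField`) and with the
  CM-type hypothesis of the milestone item `Theses.SupersingularIsotypicLift.CMAbelianHodge`
  (stmt-HodgeConjecture-3052: `End⁰(A) ⊇` a commutative reduced `ℚ`-subalgebra of dimension `2 dim A`);
* this file PROVES the typed arrow `[André 1992] → WeilClassesImaginaryQuadratic (R∞) → WeilClassesCMField (R3) →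
  CMAbelianHodge` (stmt-3052; both copies of the shared decl), i.e. the packet's v0 rung R5 is dominated by the
  two top rungs of the ladder modulo a refereed theorem in print — kernel-checked. Codimension `0` and `1`
  need no Weil class beyond R∞'s binders (`hodgeConjectureFor_codim_zero`, Lefschetz `(1,1)` discharged in the
  tree: `weilClass_mem_algebraicClasses_of_weilClassesImaginaryQuadratic` extends R∞ to every `k`); pull-backs
  of algebraic classes along `A.X ⟶ B.X` are algebraic (`map_mem_algebraicClasses_of_abelianVariety`, proved;
  packaged in the Literature lemma `mem_algebraicClasses_cmAbelianVariety_of_andre1992`). NO "split type" notion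
  for `[E:ℚ] > 2` is needed for the arrow (R3 quantifies over all `E`-Weil classes); the packet's DIVERGENCE D4 is
  thereby moot for this edge. `HodgeConjecture → CMAbelianHodge` (on-path) is recorded too.

HONEST LABEL: nothing here is a case of the Hodge conjecture proved; the fact is a theorem in print, the file a
reduction. Sorry-free; no definition.
-/

-- every declaration of this problem lives in `Summit.HodgeConjecture.HodgeConjecture.…` (summit = sub-problem)
set_option linter.dupNamespace false

noncomputable section

open CategoryTheory

namespace Summit.HodgeConjecture.HodgeConjecture.WeilTypeLadder

open Literature.AlgebraicGeometry Literature.AlgebraicGeometry.Motives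
open Literature.AlgebraicGeometry.HodgeTheory
open Literature.AlgebraicTopology.SingularHomology

/-! ### The typed arrow: André ∧ R∞ ∧ R3 ⟹ the Hodge conjecture for abelian varieties of CM type -/

/-- **Weil classes for imaginary quadratic `K` in EVERY half-dimension `k`** (not only `k ≥ 2` as in R∞):
granted `WeilClassesImaginaryQuadratic`, every rational `(k,k)` class of `weilClassesOf B ψ k d` on an abelian
`2k`-fold `B` with `ψ ≫ ψ = -d` is algebraic — `k = 0` by `N⁰H⁰ = H⁰` (`hodgeConjectureFor_codim_zero`),
`k = 1` by the rational Lefschetz `(1,1)` theorem (discharged in the tree, `lefschetzOneOne_rational_holds`),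
`k ≥ 2` by R∞. [cite: VoisinHodgeI2002, Thm. 11.30] [folklore] -/
theorem weilClass_mem_algebraicClasses_of_weilClassesImaginaryQuadratic (h : WeilClassesImaginaryQuadratic)
    {k d : ℕ} (hd : 0 < d) {B : Motives.AbelianVariety ℂ} {ψ : B ⟶ B} (hB : B.dim = 2 * k)
    (hψ : ψ ≫ ψ = -(d • 𝟙 B)) {w : complexBetti B.X (2 * k)} (hw : IsRationalClass w)
    (hwt : IsOfHodgeType (2 * k) B.X (2 * k) k k w) (hweil : w ∈ weilClassesOf B ψ k d) :
    w ∈ algebraicClasses B.X k := by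
  have hsp : Motives.IsSmoothProjective B.dim B.X := Motives.AbelianVariety.isSmoothProjective_holds
  rw [hB] at hsp
  rcases Nat.lt_or_ge k 2 with hk | hk
  · interval_cases k
    · exact hodgeConjectureFor_codim_zero w
    · exact lefschetzOneOne_rational_holds hsp w hw hwt
  · exact h k hk d hd B ψ hB hsp hψ w hw hwt hweil

/-- **The cycle part of HC for a CM abelian variety, from André's theorem and the two top rungs.** For `A` of
CM type (the hypothesis of `CMAbelianHodge`), every rational `(k,k)` class is algebraic GIVEN the named fact
`Andre1992_hodgeClasses_cmAbelianVariety_mem_span_pullback_weilClasses` (theorem in print), R∞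
(`WeilClassesImaginaryQuadratic`) and R3 (`WeilClassesCMField`): the class lies in the span of pull-backs of
Weil classes (André), each Weil class is algebraic by R∞ / R3 (with `hodgeConjectureFor_codim_zero` and
Lefschetz `(1,1)` in codimension `≤ 1`), pull-backs along `A.X ⟶ B.X` preserve algebraicity
(`map_mem_algebraicClasses_of_abelianVariety`, proved in the tree) and `algebraicClasses` is a `ℂ`-subspace.
CONDITIONAL (two open rungs + one fact); no "split type" is used. [cite: Andre1992HodgeCM, Théorème]
[cite: CharlesSchnell2014Notes, Thm. 11.5.21 (p. 510)] [cite: Markman2025SurveySecant, Thm. 1.4 and §12] -/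
theorem hodgeClasses_cmAbelianVariety_algebraic_of_andre_of_rungs
    (hA : Andre1992_hodgeClasses_cmAbelianVariety_mem_span_pullback_weilClasses)
    (h₂ : WeilClassesImaginaryQuadratic) (h₃ : WeilClassesCMField)
    (A : Motives.AbelianVariety ℂ) (hX : Motives.IsSmoothProjective A.dim A.X)
    (hCM : ∃ S : Subalgebra ℚ A.endAlgebra, IsReduced ↥S ∧ (∀ x ∈ S, ∀ y ∈ S, x * y = y * x) ∧
        Module.finrank ℚ ↥S = 2 * A.dim)
    (k : ℕ) (c : complexBetti A.X (2 * k)) (hcQ : IsRationalClass c)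
    (hcH : IsOfHodgeType A.dim A.X (2 * k) k k c) : c ∈ algebraicClasses A.X k :=
  mem_algebraicClasses_cmAbelianVariety_of_andre1992 hA
    (fun _ _ hd _ _ hB hψ _ hw hwt hweil ↦
      weilClass_mem_algebraicClasses_of_weilClassesImaginaryQuadratic h₂ hd hB hψ hw hwt hweil)
    h₃ A hX hCM k c hcQ hcH

/-- **R5 — the Hodge conjecture for complex abelian varieties of CM type (`Theses.SupersingularIsotypicLift.CMAbelianHodge`,
the shared milestone item stmt-HodgeConjecture-3052) from André's theorem and the two top rungs R∞, R3 of the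
Weil-type ladder.** CONDITIONAL: `[André 1992] → WeilClassesImaginaryQuadratic → WeilClassesCMField →
CMAbelianHodge`; the Hodge-model conjunct of `HodgeConjectureFor` is the tree's theorem
`nonempty_hodgeModel_holds`. This is the packet's v0 rung "R5 (CM type, André)" as a kernel-checked edge of
the DAG (Markman, ICM survey Thm. 1.4: "André proved that every Hodge class on an abelian variety of CM-type is
a sum of pullbacks of Weil classes … Hence the algebraicity of Weil classes for all CM fields would imply the
Hodge conjecture for abelian varieties of CM type"). [cite: Andre1992HodgeCM, Théorème]
[cite: CharlesSchnell2014Notes, Thm. 11.5.21 (p. 510)] [cite: Markman2025SurveySecant, Thm. 1.4 and §12] -/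
theorem cmAbelianHodge_of_andre_of_rungs
    (hA : Andre1992_hodgeClasses_cmAbelianVariety_mem_span_pullback_weilClasses)
    (h₂ : WeilClassesImaginaryQuadratic) (h₃ : WeilClassesCMField) : Theses.SupersingularIsotypicLift.CMAbelianHodge :=
  fun A hX hCM ↦ ⟨nonempty_hodgeModel_holds hX,
    fun k c hcQ hcH ↦ hodgeClasses_cmAbelianVariety_algebraic_of_andre_of_rungs hA h₂ h₃ A hX hCM k c hcQ hcH⟩

/-- The same edge into the ROUTE copy `RankFourFaces.CMAbelianHodge` of the shared item (identical body).
[cite: Andre1992HodgeCM, Théorème] [cite: CharlesSchnell2014Notes, Thm. 11.5.21 (p. 510)] -/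
theorem rankFourFaces_cmAbelianHodge_of_andre_of_rungs
    (hA : Andre1992_hodgeClasses_cmAbelianVariety_mem_span_pullback_weilClasses)
    (h₂ : WeilClassesImaginaryQuadratic) (h₃ : WeilClassesCMField) : Theses.RankFourFaces.CMAbelianHodge :=
  fun A hX hCM ↦ ⟨nonempty_hodgeModel_holds hX,
    fun k c hcQ hcH ↦ hodgeClasses_cmAbelianVariety_algebraic_of_andre_of_rungs hA h₂ h₃ A hX hCM k c hcQ hcH⟩

/-- **From the summit**: `HodgeConjecture → [André 1992] → CMAbelianHodge` through the on-path lemmas of R∞ and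
R3 (`Theorems/WeilTypeLadderOnPath.lean`) — so, granted the fact, R5 sits below HC and above R∞ ∧ R3 in the DAG.
(Directly, `CMAbelianHodge` is of course a case of HC with no fact needed: `cmAbelianHodge_of_hodgeConjecture`.)
[cite: Markman2025SurveySecant, Thm. 1.4] -/
theorem cmAbelianHodge_of_andre_of_hodgeConjecture
    (hA : Andre1992_hodgeClasses_cmAbelianVariety_mem_span_pullback_weilClasses) (h : _root_.HodgeConjecture) :
    Theses.SupersingularIsotypicLift.CMAbelianHodge :=
  cmAbelianHodge_of_andre_of_rungs hA (weilClassesImaginaryQuadratic_of_hodgeConjecture h)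
    (weilClassesCMField_of_hodgeConjecture h)

/-- **On-path lemma for R5**: `CMAbelianHodge` is a CASE of the summit statement (no fact needed).
[cite: Deligne2000, §1] -/
theorem cmAbelianHodge_of_hodgeConjecture (h : _root_.HodgeConjecture) : Theses.SupersingularIsotypicLift.CMAbelianHodge :=
  fun _ hX _ ↦ h hX

end Summit.HodgeConjecture.HodgeConjecture.WeilTypeLadder

end
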